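import Literature.MathematicalPhysics.QuantumFieldTheory.Balaban1983to89.B16Exp198TwoRun
import Literature.MathematicalPhysics.QuantumFieldTheory.Balaban1983to89.T4RemnantBooking

/-!
# `Balaban1983to89.T4TwoRunRateAssembly` — the AGE-GRADED two-run rate of the remnant leaves: the activity-discrepancy
budget of `B16Exp198TwoRun` over a STRUCTURED rate (RATE for young discrepant polymers, SIZE for old-born ones), and its
hand-off to `T4RemnantBooking.RemnantAgeBound` (cell `pub-balaban`, journal row T4-U5.E-c-HLOC°, SURGE NODE PROVER #05
lineage gen 10; T4-DAG v10 §5; kernel glue over unit b01's `B16Exp198TwoRun` v1.3 and unit pv16's `T4RemnantBooking` v1.2.2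
(declarations byte-identical to v1.2.1); imports only those two modules, modifies nothing; v1.0.1 of this module = DOCSTRING-ONLY,
lineage gen 12: items O1 (locator «pp. 389–390 (1.97)») and O3 («v1.2.2») of the pre-landing cross-read certificate
`b2b-balaban-b01-g14/XREAD-T4TwoRunRateAssembly-v1-prelanding.md`, cell GAPS C-b01g14-2, plus the Part G cross-read ids below;
every declaration byte-identical to v1 (p183826), whose post-landing delta cross-read is cell GAPS C-adv4-69)

HONEST FRAMING (cell `pub-balaban`, T4-DAG PAGE 1).  The cell's T4 target is the existence AND uniqueness of the continuum
limit of Bałaban's unit-scale averaged loop expectations on a finite torus — strictly beyond ultraviolet stability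
([Balaban1988Convergent] Cor. 3 p. 264; [Balaban1989LargeFieldII] Thm 1 p. 355), NOT infinite volume, NOT a mass gap, NOT the
Clay problem.  This module is KERNEL GLUE for ONE located residual of the two-run («hybrid term-by-term») matching design,
cell GAPS G-b01g11-2: *the ACTIVITY-LEVEL two-run rate of the remnant leaves exp 𝐑′^{(k)}(X) must be STRUCTURED* — a uniform
relative rate ε gives an EXTENSIVE budget (`B16Exp198TwoRun.sum_exp_mul_norm_locR_sub_le_of_uniform_rate`), a rate on a
window-local discrepant sub-catalogue a LOCAL one (`B16Exp198TwoRun.discrepancy_budget_le_volume`).  Here the rate is allowed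
to DEPEND ON THE POLYMER, ε : Dom → ℝ, dominated anchor-wise by a function `e` on the anchoring outside cubes (§1), and the
two species of record `t4/T4-EST-U5Ec.md` §7 (7b) / referee report `t4/T4-REF-U5.md` F2 are typed as what they are at the
activity level (§2): a RATE binder on the YOUNG discrepant polymers (‖F_A(Z) − F_B(Z)‖ ≤ r·A e^{−R d(Z)}; cell nodes NE-R1
two-run half / NE2⁺-LF / U5a — NOT PRINTED) and a SIZE binder on the OLD-born ones in EACH run separately
(‖F(Z)‖ ≤ σ₀·A e^{−R d(Z)} with σ₀ = ρ^{A₀} the banked slack of the hosted component of age ≥ A₀; cell node NE7b-rem — NOT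
PRINTED; print's one-run bound is the age-free case σ₀ = 1).  The triangle inequality turns the pair into ONE graded rate
(r on young, 2σ₀ on old), §1 turns the graded rate into the TWO-SUMMAND budget A e^{b+τc₁}K₀·(r·#Q_y + 2σ₀·#Q_o) (§3), and
the old summand per anchoring cube is, BY NAME, a `T4RemnantBooking.RemnantAgeBound` profile with E₀ = 2·A e^{b+τc₁}·K₀ (§4),
i.e. the input `remOld` of unit pv02's `T4MatchingClosureRem.remnantOld`; the young summand is the per-step input behind
`T4MatchingClosureRem.remnantYoung` (rate `r` = the consumer's C_y·θ^{j}·θ^{−N′A(K)} at step j, its business).  The located-leaf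
form (§3, over the located leaves of unit b02's `B16Exp198.kp_condition_rel` for BOTH runs) and the `T4NestedLevels.Ledger`
packaging (§5, through `B16Exp198TwoRun.leafSum_remnant_radius_le`) are the corollaries the two-run comparison consumes.
NOTHING of Bałaban's estimates is proved here; EVERY rate / size / locality input is a BINDER.

WHAT THIS MODULE DOES NOT DO (located, cell GAPS G-pv05g10-1).  (i) The activities F(Z) of the gas (1.90) are ABSTRACT here
(`w : Dom → ℂ`, as in units b02/b01's `B16Exp198` / `B16Exp198TwoRun`): the tree has no typing of F(Z) as a functional of the
small-field territory factors, so unit pv06's territory comparison `T4TerritoryComparison.pointwiseRatio_of_territory_dPrime`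
(a WEIGHT- or factor-level two-sided ratio in the d′-currency, node U5c / E2-rel (b)) does NOT feed the young RATE binder of §2 by
theorem — it is a pointer only; the young rate is cell nodes NE-R1 (two-run half) / NE2⁺-LF / U5a's, NOT PRINTED.  (ii) The
row's question «three producers index their rates differently (territory pending positions d′_n / bank age / the cut step) —
does the glue need a common refinement?» is answered by §1: NO common refinement of the polymer-level gradings is needed, the
budget accepts ANY ε : Dom → ℝ dominated at ONE anchoring cube per discrepant polymer by a cube function `e` (the refinement
is the anchor's: e(□) ≥ the rate class of every discrepant polymer anchored at □; two classes ⇒ e = r·𝟙_{Q_y} + 2σ₀·𝟙_{Q_o});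
the bank age enters only through σ₀ = ρ^{A₀}, the cut step only through the consumer's choice of the predicate `Young` at
step j for target K (`T4RemnantBooking.ageCut`); the territory grading d′ prices the WEIGHT side (U5c), and unit pv14's
`T4ScalePairing` is the scale-local credit/window pairing of THAT price (σ^{span} of a pending structure), not of the
activity-level rate — it is not used here.  (iii) No history / scale sum: the K-summability is `T4RemnantBooking` /
`T4MatchingClosureRem`'s (Cauchy in K on the log window), over the per-step budgets this module produces.

CITATION HEADER.  NOTHING is quoted as authority in this module and no display of [Balaban 1983–89] is asserted.  For
CONTEXT only, the loci whose FORMAT the binders follow — every one already quoted verbatim, READ AS IMAGE and cross-read in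
the citation headers of the two imported modules (unit b01's `B16Exp198TwoRun` — v1.2 XREAD ok pv14-g8, cell GAPS C-pv14-46,
v1.3 Part G XREAD ok adv8-g29 / pv20-g7, cell GAPS C-adv8-42 / C-pv20-28; unit pv16's `T4RemnantBooking` — XREAD adv9-g23, cell
GAPS C-adv9-59):
[Balaban1989LargeFieldII] T. Bałaban, *Large field renormalization. II*, Commun. Math. Phys. 122 (1989) 355–392 — pp. 389–390
(1.97) (displayed on p. 389, its c₁-clause running on to p. 390 l. 1–2; the one-run activity bound of the gas (1.90), shape
|F(Z)| ≤ A e^{−R d(Z)}), p. 390 (1.98) (the exponentiated expansion Σ_X 𝐑′^{(k)}(X)), (1.99)/(1.100) (one-run, AGE-FREE decay of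
𝐑′^{(k)}(X)), p. 388 (1.92) (one-run, age-free);
[KoteckyPreiss1986] R. Kotecký, D. Preiss, Commun. Math. Phys. 103 (1986) 491–498, Theorem p. 492 — in the tree as PROVED
theorems, entering only through `B16Exp198TwoRun`.  ABSOLUTE RULE: the two-run rate, the banked size, (1.26)_rel, the
relative volume bound, footprint-locality and `RelSubadd` are BINDERS; no manuscript under audit is cited for a disputed step;
no programme-internal claim is cited.  Everything below is [folklore]-tagged finite real analysis over those binders.

DICTIONARY (as in `B16Exp198TwoRun`).  `Dom` = domains of 𝐃_k; `Λ` = the catalogue of polymers of (1.90) at one step;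
`S ⊆ Λ` = the DISCREPANT sub-catalogue (polymers whose data the two runs do not share; the families agree off `S`);
`out Z` = the cubes of Z∖⋃_i Y_i (KP size a(Z) = τ·#out Z, anchoring, (1.26)_rel); `cubes Z` = full footprint; `d` =
d_{k,∪Y_i}; `wA`, `wB` = the activities F(Z) of the two runs at the SAME step on the COMMON background (synchronisation =
node U5a, not this module's); `Young : Dom → Prop` = «every large-field component hosted by Z is young» (age below the cut)
— a decidable predicate supplied by the consumer; `Q_y`, `Q_o` = finite sets of outside cubes anchoring the young, resp.
old, discrepant polymers; `r` = the young two-run rate, `σ₀` = the old one-run size factor (both relative to A e^{−R d}).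

CONTENTS.  §1 `weighted_norm_sub_le_of_rate` (pointwise), `discrepancy_budget_le_graded` (**Σ_{Z∈Λ}‖F_A(Z) − F_B(Z)‖
e^{τ#out Z + (r₁+s)d(Z) + b} ≤ A e^{b+τc₁}·K₀·Σ_{□∈Q} e(□)** for a graded rate ε dominated anchor-wise by e ≥ 0),
and an `example` re-deriving the LANDED `B16Exp198TwoRun.discrepancy_budget_le_volume` (constant grading e ≡ ε) from it.
§2 `norm_sub_le_of_age_split` (RATE on young / SIZE on old in both runs ⇒ one graded rate), `gradedRate_nonneg`.
§3 `discrepancy_budget_le_young_add_old` (**≤ A e^{b+τc₁}·K₀·(r·#Q_y + 2σ₀·#Q_o)**), the located-leaf form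
`sum_exp_mul_norm_locR_sub_le_young_add_old` (**Σ_{X∈𝒳} e^{r₁d(X)+b}‖𝐑′_A(X) − 𝐑′_B(X)‖ ≤ same**) over the located leaves
of `B16Exp198.kp_condition_rel` for both runs, and its graded parent `sum_exp_mul_norm_locR_sub_le_of_graded_rate`.
§4 `remnantAgeBound_oldSummand` (the old summand per anchoring cube, (j, A) ↦ 2·A e^{b+τc₁}·K₀·ρ^A, IS a `RemnantAgeBound`
profile with E₀ = 2·A e^{b+τc₁}·K₀ — `T4RemnantBooking.remnantAgeBound_saturated` by name), `oldSummand_eq_card_mul`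
(the §3 old summand = #Q_o × that profile at the cut age).  §5 `leafSum_remnant_radius_le_young_add_old` (the remnant-leaf
radii of a nested term `T4NestedLevels.Ledger` have leaf sum ≤ the two-summand budget — `B16Exp198TwoRun.leafSum_remnant_radius_le`
∘ §3), `leafSum_remnant_width_le_young_add_old` (their share of the root width ≤ twice it).  §6 sanity `example`s
(non-vacuity: the binders of §3 are jointly satisfiable with a nonzero discrepancy; the age-free case σ₀ = 1, r = 2 is the
trivial two-run bound from print's one-run format).

Value = kernel glue + a located gap (G-pv05g10-1), NOT summit progress.
-/

open Finset

namespace Literature.MathematicalPhysics.QuantumFieldTheory.Balaban1983to89.T4TwoRunRateAssembly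

open Literature.Probability.LatticeModels
open Literature.MathematicalPhysics.QuantumFieldTheory.Balaban1983to89.B13FamilySum
open Literature.MathematicalPhysics.QuantumFieldTheory.Balaban1983to89.B16Exp198
open Literature.MathematicalPhysics.QuantumFieldTheory.Balaban1983to89.B16Exp198TwoRun
open Literature.MathematicalPhysics.QuantumFieldTheory.Balaban1983to89.T4NestedLevels
open Literature.MathematicalPhysics.QuantumFieldTheory.Balaban1983to89.T4RemnantBooking

variable {Dom Cube : Type*} [DecidableEq Dom] [DecidableEq Cube]
variable (ι : Dom → Dom → Prop) [DecidableRel ι]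

/-! ## §1 The activity-discrepancy budget over a GRADED rate -/

omit [DecidableEq Dom] [DecidableEq Cube] in
/-- **Pointwise.**  A relative two-run rate `η ≥ 0` on ONE polymer `Z ∈ Λ`, ‖F_A(Z) − F_B(Z)‖ ≤ η·A e^{−R d(Z)}, with the
relative volume bound on `Λ` and the rate condition κ₀ + r₁ + s + τc₁ ≤ R, gives the weighted bound
‖F_A(Z) − F_B(Z)‖·e^{τ#out Z + (r₁+s)d(Z) + b} ≤ η·A e^{b+τc₁}·e^{−κ₀ d(Z)} (the pointwise step of
`B16Exp198TwoRun.discrepancy_budget_le_volume`, isolated so that `η` may vary with `Z`). [folklore] -/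
theorem weighted_norm_sub_le_of_rate {Λ : Finset Dom} {out : Dom → Finset Cube} {d : Dom → ℝ} {wA wB : Dom → ℂ}
    {A R r₁ s κ₀ c₁ b τ η : ℝ} (hd : ∀ Z, 0 ≤ d Z) (hA : 0 ≤ A) (hτ : 0 ≤ τ) (hη : 0 ≤ η)
    (hvol : VolBound Λ out d c₁) (hrate : κ₀ + (r₁ + s) + τ * c₁ ≤ R) {Z : Dom} (hZ : Z ∈ Λ)
    (hAB : ‖wA Z - wB Z‖ ≤ η * (A * Real.exp (-(R * d Z)))) :
    ‖wA Z - wB Z‖ * Real.exp (τ * ((out Z).card : ℝ) + ((r₁ + s) * d Z + b)) ≤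
      η * (A * Real.exp (b + τ * c₁)) * Real.exp (-(κ₀ * d Z)) := by
  have hv : τ * ((out Z).card : ℝ) ≤ τ * (c₁ * (1 + d Z)) := mul_le_mul_of_nonneg_left (hvol Z hZ) hτ
  have hexp : -(R * d Z) + (τ * (c₁ * (1 + d Z)) + ((r₁ + s) * d Z + b)) =
      (b + τ * c₁) + -((R - τ * c₁ - (r₁ + s)) * d Z) := by ring
  calc ‖wA Z - wB Z‖ * Real.exp (τ * ((out Z).card : ℝ) + ((r₁ + s) * d Z + b))
      ≤ η * (A * Real.exp (-(R * d Z))) * Real.exp (τ * (c₁ * (1 + d Z)) + ((r₁ + s) * d Z + b)) :=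
        mul_le_mul hAB (Real.exp_le_exp.2 (by linarith)) (Real.exp_nonneg _)
          (mul_nonneg hη (mul_nonneg hA (Real.exp_nonneg _)))
    _ = η * A * (Real.exp (-(R * d Z)) * Real.exp (τ * (c₁ * (1 + d Z)) + ((r₁ + s) * d Z + b))) := by ring
    _ = η * A * (Real.exp (b + τ * c₁) * Real.exp (-((R - τ * c₁ - (r₁ + s)) * d Z))) := by
        rw [← Real.exp_add, hexp, Real.exp_add]
    _ ≤ η * A * (Real.exp (b + τ * c₁) * Real.exp (-(κ₀ * d Z))) := by
        refine mul_le_mul_of_nonneg_left (mul_le_mul_of_nonneg_left (Real.exp_le_exp.2 (neg_le_neg ?_))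
          (Real.exp_nonneg _)) (mul_nonneg hη hA)
        exact mul_le_mul_of_nonneg_right (by linarith) (hd Z)
    _ = η * (A * Real.exp (b + τ * c₁)) * Real.exp (-(κ₀ * d Z)) := by ring

/-- **The activity-discrepancy budget over a GRADED rate.**  Two activity families agreeing on `Λ` off a discrepant
sub-catalogue `S ⊆ Λ`, a POLYMER-DEPENDENT relative rate on `S`, ‖F_A(Z) − F_B(Z)‖ ≤ ε(Z)·A e^{−R d(Z)}, and a finite set `Q`
of outside cubes such that every `Z ∈ S` is anchored at some `□ ∈ Q` (□ ∈ out Z) with ε(Z) ≤ e(□), `e ≥ 0` on `Q`; with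
(1.26)_rel, the relative volume bound and the rate condition κ₀ + r₁ + s + τc₁ ≤ R on `Λ`:
**Σ_{Z∈Λ}‖F_A(Z) − F_B(Z)‖e^{τ#out Z + (r₁+s)d(Z) + b} ≤ A e^{b+τc₁} · K₀ · Σ_{□∈Q} e(□)**.  The anchoring cube carries the
rate class: no common refinement of polymer-level gradings is needed beyond this anchor-wise domination. [folklore] -/
theorem discrepancy_budget_le_graded {Λ S : Finset Dom} (hS : S ⊆ Λ) {out : Dom → Finset Cube} {d : Dom → ℝ}
    {wA wB : Dom → ℂ} {A R r₁ s κ₀ K₀ c₁ b τ : ℝ} {ε : Dom → ℝ} {e : Cube → ℝ}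
    (hd : ∀ Z, 0 ≤ d Z) (hA : 0 ≤ A) (hτ : 0 ≤ τ)
    (hzero : ∀ Z ∈ Λ, Z ∉ S → wA Z = wB Z)
    (hAB : ∀ Z ∈ S, ‖wA Z - wB Z‖ ≤ ε Z * (A * Real.exp (-(R * d Z))))
    (h126 : Ineq126 Λ out d κ₀ K₀) (hvol : VolBound Λ out d c₁) (hrate : κ₀ + (r₁ + s) + τ * c₁ ≤ R)
    {Q : Finset Cube} (he : ∀ q ∈ Q, 0 ≤ e q) (hQ : ∀ Z ∈ S, ∃ q ∈ Q, q ∈ out Z ∧ ε Z ≤ e q) :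
    ∑ Z ∈ Λ, ‖wA Z - wB Z‖ * Real.exp (τ * ((out Z).card : ℝ) + ((r₁ + s) * d Z + b)) ≤
      A * Real.exp (b + τ * c₁) * K₀ * ∑ q ∈ Q, e q := by
  classical
  -- only the discrepant sub-catalogue contributes
  have hΛS : ∑ Z ∈ Λ, ‖wA Z - wB Z‖ * Real.exp (τ * ((out Z).card : ℝ) + ((r₁ + s) * d Z + b)) =
      ∑ Z ∈ S, ‖wA Z - wB Z‖ * Real.exp (τ * ((out Z).card : ℝ) + ((r₁ + s) * d Z + b)) := by
    refine (Finset.sum_subset hS fun Z hZΛ hZS => ?_).symm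
    rw [hzero Z hZΛ hZS, sub_self, norm_zero, zero_mul]
  rw [hΛS]
  set g : Dom → ℝ := fun Z => Real.exp (-(κ₀ * d Z)) with hg
  have hg0 : ∀ Z, 0 ≤ g Z := fun Z => Real.exp_nonneg _
  set f : Dom → ℝ := fun Z => ‖wA Z - wB Z‖ * Real.exp (τ * ((out Z).card : ℝ) + ((r₁ + s) * d Z + b)) with hf
  have hf0 : ∀ Z, 0 ≤ f Z := fun Z => mul_nonneg (norm_nonneg _) (Real.exp_nonneg _)
  -- the fibres of the anchoring: discrepant polymers anchored at `q` with rate class at most `e q`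
  set T : Cube → Finset Dom := fun q => S.filter fun Z => q ∈ out Z ∧ ε Z ≤ e q with hT
  have hcover : S ⊆ Q.biUnion T := by
    intro Z hZ
    obtain ⟨q, hq, hqZ, hεe⟩ := hQ Z hZ
    exact Finset.mem_biUnion.2 ⟨q, hq, Finset.mem_filter.2 ⟨hZ, hqZ, hεe⟩⟩
  have hfib : ∀ q ∈ Q, ∑ Z ∈ T q, f Z ≤ e q * (A * Real.exp (b + τ * c₁)) * K₀ := by
    intro q hq
    have hc : 0 ≤ e q * (A * Real.exp (b + τ * c₁)) := mul_nonneg (he q hq) (mul_nonneg hA (Real.exp_nonneg _))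
    have hpt : ∀ Z ∈ T q, f Z ≤ e q * (A * Real.exp (b + τ * c₁)) * g Z := by
      intro Z hZ
      obtain ⟨hZS, hqZ, hεe⟩ := Finset.mem_filter.1 hZ
      have hAB' : ‖wA Z - wB Z‖ ≤ e q * (A * Real.exp (-(R * d Z))) :=
        (hAB Z hZS).trans (mul_le_mul_of_nonneg_right hεe (mul_nonneg hA (Real.exp_nonneg _)))
      exact weighted_norm_sub_le_of_rate hd hA hτ (he q hq) hvol hrate (hS hZS) hAB'
    have hsub : T q ⊆ Λ.filter fun Z => q ∈ out Z := fun Z hZ => by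
      obtain ⟨hZS, hqZ, _⟩ := Finset.mem_filter.1 hZ
      exact Finset.mem_filter.2 ⟨hS hZS, hqZ⟩
    calc ∑ Z ∈ T q, f Z ≤ ∑ Z ∈ T q, e q * (A * Real.exp (b + τ * c₁)) * g Z := Finset.sum_le_sum hpt
      _ = e q * (A * Real.exp (b + τ * c₁)) * ∑ Z ∈ T q, g Z := by rw [Finset.mul_sum]
      _ ≤ e q * (A * Real.exp (b + τ * c₁)) * ∑ Z ∈ Λ.filter (fun Z => q ∈ out Z), g Z :=
          mul_le_mul_of_nonneg_left (Finset.sum_le_sum_of_subset_of_nonneg hsub fun Z _ _ => hg0 Z) hc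
      _ ≤ e q * (A * Real.exp (b + τ * c₁)) * K₀ := mul_le_mul_of_nonneg_left (h126 q) hc
  calc ∑ Z ∈ S, f Z ≤ ∑ Z ∈ Q.biUnion T, f Z := Finset.sum_le_sum_of_subset_of_nonneg hcover fun Z _ _ => hf0 Z
    _ ≤ ∑ q ∈ Q, ∑ Z ∈ T q, f Z := sum_biUnion_le_sum_of_nonneg _ _ f hf0
    _ ≤ ∑ q ∈ Q, e q * (A * Real.exp (b + τ * c₁)) * K₀ := Finset.sum_le_sum hfib
    _ = A * Real.exp (b + τ * c₁) * K₀ * ∑ q ∈ Q, e q := by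
        rw [Finset.mul_sum]
        exact Finset.sum_congr rfl fun q _ => by ring

/-- CONSISTENCY (an `example`, no new declaration: the statement below IS the landed
`B16Exp198TwoRun.discrepancy_budget_le_volume`, b01 v1.3, which consumers cite BY NAME): the constant grading e ≡ ε ≥ 0 in
`discrepancy_budget_le_graded` gives back its right-hand side ε · A e^{b+τc₁} · K₀ · #Q — the graded budget is a genuine
generalisation of the uniform-rate reading, not a different inequality. [folklore] -/
example {Λ S : Finset Dom} (hS : S ⊆ Λ) {out : Dom → Finset Cube} {d : Dom → ℝ}
    {wA wB : Dom → ℂ} {A R r₁ s κ₀ K₀ c₁ b τ ε : ℝ}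
    (hd : ∀ Z, 0 ≤ d Z) (hA : 0 ≤ A) (hτ : 0 ≤ τ) (hε : 0 ≤ ε)
    (hzero : ∀ Z ∈ Λ, Z ∉ S → wA Z = wB Z)
    (hAB : ∀ Z ∈ S, ‖wA Z - wB Z‖ ≤ ε * (A * Real.exp (-(R * d Z))))
    (h126 : Ineq126 Λ out d κ₀ K₀) (hvol : VolBound Λ out d c₁) (hrate : κ₀ + (r₁ + s) + τ * c₁ ≤ R)
    {Q : Finset Cube} (hQ : ∀ Z ∈ S, ∃ q ∈ Q, q ∈ out Z) :
    ∑ Z ∈ Λ, ‖wA Z - wB Z‖ * Real.exp (τ * ((out Z).card : ℝ) + ((r₁ + s) * d Z + b)) ≤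
      ε * (A * Real.exp (b + τ * c₁)) * K₀ * (Q.card : ℝ) := by
  have h := discrepancy_budget_le_graded hS (b := b) (ε := fun _ => ε) (e := fun _ => ε) hd hA hτ hzero hAB h126 hvol
    hrate (Q := Q) (fun _ _ => hε) fun Z hZ => by
      obtain ⟨q, hq, hqZ⟩ := hQ Z hZ
      exact ⟨q, hq, hqZ, le_rfl⟩
  rw [Finset.sum_const, nsmul_eq_mul] at h
  linarith [h]

/-! ## §2 The activity-level age split: RATE on young discrepant polymers, SIZE on old-born ones -/

omit [DecidableEq Dom] in
/-- **One graded rate from the two species** (record `t4/T4-EST-U5Ec.md` §7 (7b); referee report `t4/T4-REF-U5.md` F2;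
cell GAPS G-b01g11-2 — binders, NOT PRINTED).  On the discrepant sub-catalogue `S`: a two-run RATE on the YOUNG polymers,
‖F_A(Z) − F_B(Z)‖ ≤ r(Z)·M(Z), and a one-run SIZE bound in EACH run on the OLD-born ones, ‖F(Z)‖ ≤ σ(Z)·M(Z), give the
graded two-run rate ‖F_A(Z) − F_B(Z)‖ ≤ (if Young Z then r Z else 2·σ Z)·M(Z) on `S` (triangle inequality; `M` is the
common decay profile, A e^{−R d(Z)} in §3). [folklore] -/
theorem norm_sub_le_of_age_split {S : Finset Dom} (Young : Dom → Prop) [DecidablePred Young] {wA wB : Dom → ℂ}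
    {M r σ : Dom → ℝ}
    (hrate : ∀ Z ∈ S, Young Z → ‖wA Z - wB Z‖ ≤ r Z * M Z)
    (hsizeA : ∀ Z ∈ S, ¬Young Z → ‖wA Z‖ ≤ σ Z * M Z) (hsizeB : ∀ Z ∈ S, ¬Young Z → ‖wB Z‖ ≤ σ Z * M Z) :
    ∀ Z ∈ S, ‖wA Z - wB Z‖ ≤ (if Young Z then r Z else 2 * σ Z) * M Z := by
  intro Z hZ
  split_ifs with hY
  · exact hrate Z hZ hY
  · calc ‖wA Z - wB Z‖ ≤ ‖wA Z‖ + ‖wB Z‖ := norm_sub_le _ _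
      _ ≤ σ Z * M Z + σ Z * M Z := add_le_add (hsizeA Z hZ hY) (hsizeB Z hZ hY)
      _ = 2 * σ Z * M Z := by ring

omit [DecidableEq Dom] in
/-- The graded rate is nonnegative when `r, σ ≥ 0`. [folklore] -/
theorem gradedRate_nonneg (Young : Dom → Prop) [DecidablePred Young] {r σ : Dom → ℝ} (hr : ∀ Z, 0 ≤ r Z)
    (hσ : ∀ Z, 0 ≤ σ Z) (Z : Dom) : 0 ≤ (if Young Z then r Z else 2 * σ Z) := by
  split_ifs
  · exact hr Z
  · exact mul_nonneg zero_le_two (hσ Z)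

/-! ## §3 The TWO-SUMMAND budget: young anchors pay the rate, old anchors pay twice the banked size -/

/-- The sum of the two-class anchor grading over `Q_y ∪ Q_o` is `r·#Q_y + 2σ₀·#Q_o`. [folklore] -/
theorem sum_twoClass_grading (Qy Qo : Finset Cube) (r σ₀ : ℝ) :
    ∑ q ∈ Qy ∪ Qo, ((if q ∈ Qy then r else 0) + (if q ∈ Qo then 2 * σ₀ else 0)) =
      r * (Qy.card : ℝ) + 2 * σ₀ * (Qo.card : ℝ) := by
  rw [Finset.sum_add_distrib, Finset.sum_ite_mem, Finset.sum_ite_mem, Finset.union_inter_cancel_left,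
    Finset.union_inter_cancel_right, Finset.sum_const, Finset.sum_const, nsmul_eq_mul, nsmul_eq_mul]
  ring

/-- **The two-summand activity-discrepancy budget.**  Two activity families agreeing on `Λ` off the discrepant sub-catalogue
`S ⊆ Λ`; a decidable class `Young` of polymers; on `S`, the two-run RATE ‖F_A(Z) − F_B(Z)‖ ≤ r·A e^{−R d(Z)} for the young
polymers and the one-run SIZE ‖F(Z)‖ ≤ σ₀·A e^{−R d(Z)} in EACH run for the old-born ones (`r, σ₀ ≥ 0`; σ₀ = ρ^{A₀}, the banked
slack of a hosted component of age ≥ A₀ — NOT PRINTED; σ₀ = 1 is print's age-free one-run format); finite sets `Q_y`, `Q_o`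
of outside cubes anchoring the young, resp. old, discrepant polymers; (1.26)_rel, the relative volume bound and the rate
condition on `Λ`.  Then **Σ_{Z∈Λ}‖F_A(Z) − F_B(Z)‖e^{τ#out Z + (r₁+s)d(Z) + b} ≤ A e^{b+τc₁} · K₀ · (r·#Q_y + 2σ₀·#Q_o)** —
the young summand is LOCAL with the rate (window-local #Q_y, cell NE-R1 / NE2⁺-LF / U5a), the old summand is trivially
counted with the banked size (cell NE7b-rem). [folklore] -/
theorem discrepancy_budget_le_young_add_old {Λ S : Finset Dom} (hS : S ⊆ Λ) {out : Dom → Finset Cube} {d : Dom → ℝ}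
    {wA wB : Dom → ℂ} {A R r₁ s κ₀ K₀ c₁ b τ r σ₀ : ℝ}
    (hd : ∀ Z, 0 ≤ d Z) (hA : 0 ≤ A) (hτ : 0 ≤ τ) (hr : 0 ≤ r) (hσ₀ : 0 ≤ σ₀)
    (hzero : ∀ Z ∈ Λ, Z ∉ S → wA Z = wB Z)
    (Young : Dom → Prop) [DecidablePred Young]
    (hrate : ∀ Z ∈ S, Young Z → ‖wA Z - wB Z‖ ≤ r * (A * Real.exp (-(R * d Z))))
    (hsizeA : ∀ Z ∈ S, ¬Young Z → ‖wA Z‖ ≤ σ₀ * (A * Real.exp (-(R * d Z))))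
    (hsizeB : ∀ Z ∈ S, ¬Young Z → ‖wB Z‖ ≤ σ₀ * (A * Real.exp (-(R * d Z))))
    (h126 : Ineq126 Λ out d κ₀ K₀) (hvol : VolBound Λ out d c₁) (hrate' : κ₀ + (r₁ + s) + τ * c₁ ≤ R)
    {Qy Qo : Finset Cube} (hQy : ∀ Z ∈ S, Young Z → ∃ q ∈ Qy, q ∈ out Z)
    (hQo : ∀ Z ∈ S, ¬Young Z → ∃ q ∈ Qo, q ∈ out Z) :
    ∑ Z ∈ Λ, ‖wA Z - wB Z‖ * Real.exp (τ * ((out Z).card : ℝ) + ((r₁ + s) * d Z + b)) ≤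
      A * Real.exp (b + τ * c₁) * K₀ * (r * (Qy.card : ℝ) + 2 * σ₀ * (Qo.card : ℝ)) := by
  classical
  -- the graded rate on `S`
  have hAB := norm_sub_le_of_age_split (S := S) Young (M := fun Z => A * Real.exp (-(R * d Z)))
    (r := fun _ => r) (σ := fun _ => σ₀) hrate hsizeA hsizeB
  -- the two-class anchor grading
  rw [← sum_twoClass_grading Qy Qo r σ₀]
  refine discrepancy_budget_le_graded hS (ε := fun Z => if Young Z then r else 2 * σ₀)
    (e := fun q => (if q ∈ Qy then r else 0) + (if q ∈ Qo then 2 * σ₀ else 0)) hd hA hτ hzero hAB h126 hvol hrate'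
    (Q := Qy ∪ Qo) (fun q _ => add_nonneg ?_ ?_) fun Z hZ => ?_
  · split_ifs
    · exact hr
    · exact le_rfl
  · split_ifs
    · exact mul_nonneg zero_le_two hσ₀
    · exact le_rfl
  · by_cases hY : Young Z
    · obtain ⟨q, hq, hqZ⟩ := hQy Z hZ hY
      refine ⟨q, Finset.mem_union_left _ hq, hqZ, ?_⟩
      rw [if_pos hY, if_pos hq]
      have h2 : 0 ≤ (if q ∈ Qo then 2 * σ₀ else 0) := by
        split_ifs
        · exact mul_nonneg zero_le_two hσ₀
        · exact le_rfl
      linarith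
    · obtain ⟨q, hq, hqZ⟩ := hQo Z hZ hY
      refine ⟨q, Finset.mem_union_right _ hq, hqZ, ?_⟩
      rw [if_neg hY, if_pos hq]
      have h1 : 0 ≤ (if q ∈ Qy then r else 0) := by
        split_ifs
        · exact hr
        · exact le_rfl
      linarith

/-- **The remnant leaves over a graded rate, located form.**  Under the located leaves of `B16Exp198.kp_condition_rel` for
BOTH families on the COMMON geometry (footprint-local incompatibility (reach, ν), activities supported in `Λ` with
|F(Z)| ≤ A e^{−R d(Z)}, (1.26)_rel (κ₀, K₀), the relative volume bound (c₁), the rate condition κ₀ + r₁ + s + τc₁ ≤ R, the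
smallness A e^{b+τc₁}K₀ν ≤ τ), `RelSubadd` (cost c, b ≥ r₁c) on every `X ∈ 𝒳`, the two families agreeing off `S ⊆ Λ` with a
GRADED rate ε on `S` dominated anchor-wise by `e ≥ 0` on `Q`:
**Σ_{X∈𝒳} e^{r₁d(X)+b}‖𝐑′_A(X) − 𝐑′_B(X)‖ ≤ A e^{b+τc₁} · K₀ · Σ_{□∈Q} e(□)** (`B16Exp198TwoRun.sum_exp_mul_norm_locR_sub_le_of_leaves`
∘ `discrepancy_budget_le_graded`). [folklore] -/
theorem sum_exp_mul_norm_locR_sub_le_of_graded_rate [Fintype Dom] [Std.Refl ι] [Std.Symm ι] {Λ S : Finset Dom}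
    (hS : S ⊆ Λ) {cubes out reach : Dom → Finset Cube} {d : Dom → ℝ} {wA wB : Dom → ℂ}
    {A R r₁ s κ₀ K₀ c₁ c b τ ν : ℝ} {ε : Dom → ℝ} {e : Cube → ℝ}
    (hloc : ∀ Z, ∀ Z' ∈ Λ, ι Z' Z → ∃ q ∈ reach Z, q ∈ out Z')
    (hreach : ∀ Z, ((reach Z).card : ℝ) ≤ ν * (out Z).card)
    (hd : ∀ Z, 0 ≤ d Z) (hA : 0 ≤ A) (hK₀ : 0 ≤ K₀) (hτ : 0 ≤ τ)
    (hr₁ : 0 ≤ r₁) (hs : 0 ≤ s) (hc : 0 ≤ c) (hb : r₁ * c ≤ b)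
    (hwAΛ : ∀ Z, Z ∉ Λ → wA Z = 0) (hwBΛ : ∀ Z, Z ∉ Λ → wB Z = 0)
    (hwA : ∀ Z, ‖wA Z‖ ≤ A * Real.exp (-(R * d Z))) (hwB : ∀ Z, ‖wB Z‖ ≤ A * Real.exp (-(R * d Z)))
    (hzero : ∀ Z ∈ Λ, Z ∉ S → wA Z = wB Z)
    (hAB : ∀ Z ∈ S, ‖wA Z - wB Z‖ ≤ ε Z * (A * Real.exp (-(R * d Z))))
    (h126 : Ineq126 Λ out d κ₀ K₀) (hvol : VolBound Λ out d c₁)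
    (hrate : κ₀ + (r₁ + s) + τ * c₁ ≤ R) (hsmall : A * Real.exp (b + τ * c₁) * K₀ * ν ≤ τ)
    {Q : Finset Cube} (he : ∀ q ∈ Q, 0 ≤ e q) (hQ : ∀ Z ∈ S, ∃ q ∈ Q, q ∈ out Z ∧ ε Z ≤ e q)
    (𝒳 : Finset (Finset Cube)) (dX : Finset Cube → ℝ) (hsub : ∀ X ∈ 𝒳, RelSubadd ι Λ cubes d X (dX X) c) :
    ∑ X ∈ 𝒳, Real.exp (r₁ * dX X + b) * ‖locR ι Λ cubes wA X - locR ι Λ cubes wB X‖ ≤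
      A * Real.exp (b + τ * c₁) * K₀ * ∑ q ∈ Q, e q :=
  (sum_exp_mul_norm_locR_sub_le_of_leaves ι hloc hreach hd hA hK₀ hτ hr₁ hs hc hb hwAΛ hwBΛ hwA hwB
    h126 hvol hrate hsmall 𝒳 dX hsub).trans
    (discrepancy_budget_le_graded hS hd hA hτ hzero hAB h126 hvol hrate he hQ)

/-- **The remnant leaves over the age split, located form** — the row's deliverable: under the located leaves of
`B16Exp198.kp_condition_rel` for BOTH runs, `RelSubadd` on every `X ∈ 𝒳`, the families agreeing off `S ⊆ Λ`, the young RATE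
`r` and the old SIZE `σ₀` on `S` with their anchoring sets `Q_y`, `Q_o`:
**Σ_{X∈𝒳} e^{r₁d(X)+b}‖𝐑′_A(X) − 𝐑′_B(X)‖ ≤ A e^{b+τc₁} · K₀ · (r·#Q_y + 2σ₀·#Q_o)**. [folklore] -/
theorem sum_exp_mul_norm_locR_sub_le_young_add_old [Fintype Dom] [Std.Refl ι] [Std.Symm ι] {Λ S : Finset Dom}
    (hS : S ⊆ Λ) {cubes out reach : Dom → Finset Cube} {d : Dom → ℝ} {wA wB : Dom → ℂ}
    {A R r₁ s κ₀ K₀ c₁ c b τ ν r σ₀ : ℝ}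
    (hloc : ∀ Z, ∀ Z' ∈ Λ, ι Z' Z → ∃ q ∈ reach Z, q ∈ out Z')
    (hreach : ∀ Z, ((reach Z).card : ℝ) ≤ ν * (out Z).card)
    (hd : ∀ Z, 0 ≤ d Z) (hA : 0 ≤ A) (hK₀ : 0 ≤ K₀) (hτ : 0 ≤ τ) (hr : 0 ≤ r) (hσ₀ : 0 ≤ σ₀)
    (hr₁ : 0 ≤ r₁) (hs : 0 ≤ s) (hc : 0 ≤ c) (hb : r₁ * c ≤ b)
    (hwAΛ : ∀ Z, Z ∉ Λ → wA Z = 0) (hwBΛ : ∀ Z, Z ∉ Λ → wB Z = 0)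
    (hwA : ∀ Z, ‖wA Z‖ ≤ A * Real.exp (-(R * d Z))) (hwB : ∀ Z, ‖wB Z‖ ≤ A * Real.exp (-(R * d Z)))
    (hzero : ∀ Z ∈ Λ, Z ∉ S → wA Z = wB Z)
    (Young : Dom → Prop) [DecidablePred Young]
    (hrate : ∀ Z ∈ S, Young Z → ‖wA Z - wB Z‖ ≤ r * (A * Real.exp (-(R * d Z))))
    (hsizeA : ∀ Z ∈ S, ¬Young Z → ‖wA Z‖ ≤ σ₀ * (A * Real.exp (-(R * d Z))))
    (hsizeB : ∀ Z ∈ S, ¬Young Z → ‖wB Z‖ ≤ σ₀ * (A * Real.exp (-(R * d Z))))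
    (h126 : Ineq126 Λ out d κ₀ K₀) (hvol : VolBound Λ out d c₁)
    (hrate' : κ₀ + (r₁ + s) + τ * c₁ ≤ R) (hsmall : A * Real.exp (b + τ * c₁) * K₀ * ν ≤ τ)
    {Qy Qo : Finset Cube} (hQy : ∀ Z ∈ S, Young Z → ∃ q ∈ Qy, q ∈ out Z)
    (hQo : ∀ Z ∈ S, ¬Young Z → ∃ q ∈ Qo, q ∈ out Z)
    (𝒳 : Finset (Finset Cube)) (dX : Finset Cube → ℝ) (hsub : ∀ X ∈ 𝒳, RelSubadd ι Λ cubes d X (dX X) c) :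
    ∑ X ∈ 𝒳, Real.exp (r₁ * dX X + b) * ‖locR ι Λ cubes wA X - locR ι Λ cubes wB X‖ ≤
      A * Real.exp (b + τ * c₁) * K₀ * (r * (Qy.card : ℝ) + 2 * σ₀ * (Qo.card : ℝ)) :=
  (sum_exp_mul_norm_locR_sub_le_of_leaves ι hloc hreach hd hA hK₀ hτ hr₁ hs hc hb hwAΛ hwBΛ hwA hwB
    h126 hvol hrate' hsmall 𝒳 dX hsub).trans
    (discrepancy_budget_le_young_add_old hS hd hA hτ hr hσ₀ hzero Young hrate hsizeA hsizeB h126 hvol hrate' hQy hQo)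

/-! ## §4 Liaison BY NAME with `T4RemnantBooking.RemnantAgeBound` -/

/-- **The old summand per anchoring cube is a `RemnantAgeBound` profile.**  With σ₀ = ρ^A the banked slack at age `A`
(`0 ≤ ρ`), the per-cube old summand of `discrepancy_budget_le_young_add_old`, (j, A) ↦ 2·A_F e^{b+τc₁}·K₀·ρ^A (uniform in
the step `j`; a step-dependent constant is the consumer's `RemnantAgeBound.mono`), satisfies
`T4RemnantBooking.RemnantAgeBound` with E₀ = 2·A_F e^{b+τc₁}·K₀ — `T4RemnantBooking.remnantAgeBound_saturated` by name
(`A_F, K₀ ≥ 0`).  This is the shape of the input `remOld` of `T4MatchingClosureRem.remnantOld`; the normalisation «per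
scale-j cube» is the anchoring cube's. [folklore] -/
theorem remnantAgeBound_oldSummand {A b τ c₁ K₀ ρ : ℝ} (hA : 0 ≤ A) (hK₀ : 0 ≤ K₀) (hρ : 0 ≤ ρ) :
    RemnantAgeBound (fun _ n => 2 * (A * Real.exp (b + τ * c₁)) * K₀ * ρ ^ n) (2 * (A * Real.exp (b + τ * c₁)) * K₀) ρ :=
  remnantAgeBound_saturated (mul_nonneg (mul_nonneg zero_le_two (mul_nonneg hA (Real.exp_nonneg _))) hK₀) hρ

omit [DecidableEq Cube] in
/-- READING of the old summand: at banked size σ₀ = ρ^{A₀}, the old summand of `discrepancy_budget_le_young_add_old` is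
#Q_o times the `RemnantAgeBound` profile of `remnantAgeBound_oldSummand` evaluated at the cut age `A₀`. [folklore] -/
theorem oldSummand_eq_card_mul (A b τ c₁ K₀ ρ : ℝ) (A₀ : ℕ) (Qo : Finset Cube) :
    A * Real.exp (b + τ * c₁) * K₀ * (2 * ρ ^ A₀ * (Qo.card : ℝ)) =
      (Qo.card : ℝ) * (fun (_ : ℕ) (n : ℕ) => 2 * (A * Real.exp (b + τ * c₁)) * K₀ * ρ ^ n) 0 A₀ := by
  simp only
  ring

/-- **The two-summand budget in bank-age form**: the conclusion of `discrepancy_budget_le_young_add_old` with σ₀ = ρ^{A₀}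
rewritten as «young rate term + #Q_o × (RemnantAgeBound profile at the cut age)». [folklore] -/
theorem discrepancy_budget_le_young_add_remOld {Λ S : Finset Dom} (hS : S ⊆ Λ) {out : Dom → Finset Cube} {d : Dom → ℝ}
    {wA wB : Dom → ℂ} {A R r₁ s κ₀ K₀ c₁ b τ r ρ : ℝ} {A₀ : ℕ}
    (hd : ∀ Z, 0 ≤ d Z) (hA : 0 ≤ A) (hτ : 0 ≤ τ) (hr : 0 ≤ r) (hρ : 0 ≤ ρ)
    (hzero : ∀ Z ∈ Λ, Z ∉ S → wA Z = wB Z)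
    (Young : Dom → Prop) [DecidablePred Young]
    (hrate : ∀ Z ∈ S, Young Z → ‖wA Z - wB Z‖ ≤ r * (A * Real.exp (-(R * d Z))))
    (hsizeA : ∀ Z ∈ S, ¬Young Z → ‖wA Z‖ ≤ ρ ^ A₀ * (A * Real.exp (-(R * d Z))))
    (hsizeB : ∀ Z ∈ S, ¬Young Z → ‖wB Z‖ ≤ ρ ^ A₀ * (A * Real.exp (-(R * d Z))))
    (h126 : Ineq126 Λ out d κ₀ K₀) (hvol : VolBound Λ out d c₁) (hrate' : κ₀ + (r₁ + s) + τ * c₁ ≤ R)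
    {Qy Qo : Finset Cube} (hQy : ∀ Z ∈ S, Young Z → ∃ q ∈ Qy, q ∈ out Z)
    (hQo : ∀ Z ∈ S, ¬Young Z → ∃ q ∈ Qo, q ∈ out Z) :
    ∑ Z ∈ Λ, ‖wA Z - wB Z‖ * Real.exp (τ * ((out Z).card : ℝ) + ((r₁ + s) * d Z + b)) ≤
      A * Real.exp (b + τ * c₁) * K₀ * r * (Qy.card : ℝ) +
        (Qo.card : ℝ) * ((fun (_ : ℕ) (n : ℕ) => 2 * (A * Real.exp (b + τ * c₁)) * K₀ * ρ ^ n) 0 A₀) := by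
  have h := discrepancy_budget_le_young_add_old hS (b := b) hd hA hτ hr (pow_nonneg hρ A₀) hzero Young hrate hsizeA
    hsizeB h126 hvol hrate' hQy hQo
  have e : A * Real.exp (b + τ * c₁) * K₀ * (r * (Qy.card : ℝ) + 2 * ρ ^ A₀ * (Qo.card : ℝ)) =
      A * Real.exp (b + τ * c₁) * K₀ * r * (Qy.card : ℝ) +
        (Qo.card : ℝ) * ((fun (_ : ℕ) (n : ℕ) => 2 * (A * Real.exp (b + τ * c₁)) * K₀ * ρ ^ n) 0 A₀) := by
    simp only
    ring
  rw [← e]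
  exact h

/-! ## §5 Packaging BY NAME into `T4NestedLevels.Ledger`: the remnant leaves of a nested term, two-summand budget -/

/-- **Remnant-leaf radii of a nested term have leaf sum ≤ the two-summand budget.**  Located leaves of
`B16Exp198.kp_condition_rel` for BOTH runs (hypothesis (1) on the catalogue via `B16Exp198TwoRun.kpd_catalogue`), the families
agreeing off `S ⊆ Λ`, the young RATE / old SIZE binders with anchoring sets `Q_y`, `Q_o`; a ledger `t : T4NestedLevels.Ledger ιL O`
with distinct leaf labels, remnant leaves `rem` with localization domains `dom` injective on `rem`.  Then
`t.leafSum (i ↦ if i ∈ rem then ‖𝐑′_A(dom i) − 𝐑′_B(dom i)‖ else 0) ≤ A e^{b+τc₁}·K₀·(r·#Q_y + 2σ₀·#Q_o)`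
(`B16Exp198TwoRun.leafSum_remnant_radius_le` ∘ `discrepancy_budget_le_young_add_old`; `b ≥ 0` for the KP weight d_K ≥ 0).
[folklore] -/
theorem leafSum_remnant_radius_le_young_add_old [Fintype Dom] [Std.Refl ι] [Std.Symm ι] {Λ S : Finset Dom}
    (hS : S ⊆ Λ) {cubes out reach : Dom → Finset Cube} {d : Dom → ℝ} {wA wB : Dom → ℂ}
    {A R r₁ s κ₀ K₀ c₁ b τ ν r σ₀ : ℝ}
    (hloc : ∀ Z, ∀ Z' ∈ Λ, ι Z' Z → ∃ q ∈ reach Z, q ∈ out Z')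
    (hreach : ∀ Z, ((reach Z).card : ℝ) ≤ ν * (out Z).card)
    (hd : ∀ Z, 0 ≤ d Z) (hA : 0 ≤ A) (hK₀ : 0 ≤ K₀) (hτ : 0 ≤ τ) (hr : 0 ≤ r) (hσ₀ : 0 ≤ σ₀)
    (hr₁ : 0 ≤ r₁) (hs : 0 ≤ s) (hb : 0 ≤ b)
    (hwAΛ : ∀ Z, Z ∉ Λ → wA Z = 0) (hwBΛ : ∀ Z, Z ∉ Λ → wB Z = 0)
    (hwA : ∀ Z, ‖wA Z‖ ≤ A * Real.exp (-(R * d Z))) (hwB : ∀ Z, ‖wB Z‖ ≤ A * Real.exp (-(R * d Z)))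
    (hzero : ∀ Z ∈ Λ, Z ∉ S → wA Z = wB Z)
    (Young : Dom → Prop) [DecidablePred Young]
    (hrate : ∀ Z ∈ S, Young Z → ‖wA Z - wB Z‖ ≤ r * (A * Real.exp (-(R * d Z))))
    (hsizeA : ∀ Z ∈ S, ¬Young Z → ‖wA Z‖ ≤ σ₀ * (A * Real.exp (-(R * d Z))))
    (hsizeB : ∀ Z ∈ S, ¬Young Z → ‖wB Z‖ ≤ σ₀ * (A * Real.exp (-(R * d Z))))
    (h126 : Ineq126 Λ out d κ₀ K₀) (hvol : VolBound Λ out d c₁)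
    (hrate' : κ₀ + (r₁ + s) + τ * c₁ ≤ R) (hsmall : A * Real.exp (b + τ * c₁) * K₀ * ν ≤ τ)
    {Qy Qo : Finset Cube} (hQy : ∀ Z ∈ S, Young Z → ∃ q ∈ Qy, q ∈ out Z)
    (hQo : ∀ Z ∈ S, ¬Young Z → ∃ q ∈ Qo, q ∈ out Z)
    {ιL O : Type*} [DecidableEq ιL] {t : Ledger ιL O} (hnd : t.leaves.Nodup) (rem : Finset ιL)
    {dom : ιL → Finset Cube} (hinj : Set.InjOn dom ↑rem) :
    t.leafSum (fun i => if i ∈ rem then ‖locR ι Λ cubes wA (dom i) - locR ι Λ cubes wB (dom i)‖ else 0) ≤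
      A * Real.exp (b + τ * c₁) * K₀ * (r * (Qy.card : ℝ) + 2 * σ₀ * (Qo.card : ℝ)) := by
  have ha : ∀ Z, 0 ≤ τ * ((out Z).card : ℝ) := fun Z => mul_nonneg hτ (Nat.cast_nonneg _)
  have hdK : ∀ Z, 0 ≤ (r₁ + s) * d Z + b := fun Z => add_nonneg (mul_nonneg (add_nonneg hr₁ hs) (hd Z)) hb
  have hrate0 : κ₀ + (r₁ + s) + τ * c₁ ≤ R := hrate'
  have h1A := kpd_catalogue ι (s := r₁ + s) hloc hreach hd hA hK₀ hτ hwAΛ hwA h126 hvol hrate0 hsmall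
  have h1B := kpd_catalogue ι (s := r₁ + s) hloc hreach hd hA hK₀ hτ hwBΛ hwB h126 hvol hrate0 hsmall
  exact (leafSum_remnant_radius_le ι (cubes := cubes) (a := fun Z => τ * ((out Z).card : ℝ))
    (dK := fun Z => (r₁ + s) * d Z + b) ha hdK h1A h1B hnd rem hinj).trans
    (discrepancy_budget_le_young_add_old hS hd hA hτ hr hσ₀ hzero Young hrate hsizeA hsizeB h126 hvol hrate' hQy hQo)

/-- **The remnant leaves' share of the root width is at most twice the two-summand budget**: with leaf bounds
(l i, u i) = (−r_i, r_i) on `rem` (0 off `rem`), `t.upper u − t.lower l ≤ 2·A e^{b+τc₁}·K₀·(r·#Q_y + 2σ₀·#Q_o)` — the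
quantity of `T4NestedLevels.Ledger.width_le_leafSum`. [folklore] -/
theorem leafSum_remnant_width_le_young_add_old [Fintype Dom] [Std.Refl ι] [Std.Symm ι] {Λ S : Finset Dom}
    (hS : S ⊆ Λ) {cubes out reach : Dom → Finset Cube} {d : Dom → ℝ} {wA wB : Dom → ℂ}
    {A R r₁ s κ₀ K₀ c₁ b τ ν r σ₀ : ℝ}
    (hloc : ∀ Z, ∀ Z' ∈ Λ, ι Z' Z → ∃ q ∈ reach Z, q ∈ out Z')
    (hreach : ∀ Z, ((reach Z).card : ℝ) ≤ ν * (out Z).card)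
    (hd : ∀ Z, 0 ≤ d Z) (hA : 0 ≤ A) (hK₀ : 0 ≤ K₀) (hτ : 0 ≤ τ) (hr : 0 ≤ r) (hσ₀ : 0 ≤ σ₀)
    (hr₁ : 0 ≤ r₁) (hs : 0 ≤ s) (hb : 0 ≤ b)
    (hwAΛ : ∀ Z, Z ∉ Λ → wA Z = 0) (hwBΛ : ∀ Z, Z ∉ Λ → wB Z = 0)
    (hwA : ∀ Z, ‖wA Z‖ ≤ A * Real.exp (-(R * d Z))) (hwB : ∀ Z, ‖wB Z‖ ≤ A * Real.exp (-(R * d Z)))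
    (hzero : ∀ Z ∈ Λ, Z ∉ S → wA Z = wB Z)
    (Young : Dom → Prop) [DecidablePred Young]
    (hrate : ∀ Z ∈ S, Young Z → ‖wA Z - wB Z‖ ≤ r * (A * Real.exp (-(R * d Z))))
    (hsizeA : ∀ Z ∈ S, ¬Young Z → ‖wA Z‖ ≤ σ₀ * (A * Real.exp (-(R * d Z))))
    (hsizeB : ∀ Z ∈ S, ¬Young Z → ‖wB Z‖ ≤ σ₀ * (A * Real.exp (-(R * d Z))))
    (h126 : Ineq126 Λ out d κ₀ K₀) (hvol : VolBound Λ out d c₁)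
    (hrate' : κ₀ + (r₁ + s) + τ * c₁ ≤ R) (hsmall : A * Real.exp (b + τ * c₁) * K₀ * ν ≤ τ)
    {Qy Qo : Finset Cube} (hQy : ∀ Z ∈ S, Young Z → ∃ q ∈ Qy, q ∈ out Z)
    (hQo : ∀ Z ∈ S, ¬Young Z → ∃ q ∈ Qo, q ∈ out Z)
    {ιL O : Type*} [DecidableEq ιL] {t : Ledger ιL O} (hnd : t.leaves.Nodup) (rem : Finset ιL)
    {dom : ιL → Finset Cube} (hinj : Set.InjOn dom ↑rem) :
    let rad : ιL → ℝ := fun i => if i ∈ rem then ‖locR ι Λ cubes wA (dom i) - locR ι Λ cubes wB (dom i)‖ else 0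
    t.upper rad - t.lower (fun i => -rad i) ≤
      2 * (A * Real.exp (b + τ * c₁) * K₀ * (r * (Qy.card : ℝ) + 2 * σ₀ * (Qo.card : ℝ))) := by
  intro rad
  have hr0 : ∀ i, 0 ≤ rad i := fun i => by
    simp only [rad]; split_ifs
    · exact norm_nonneg _
    · exact le_rfl
  have hw := Ledger.width_le_leafSum (l := fun i => -rad i) (u := rad) (fun i => neg_nonpos.2 (hr0 i)) hr0 t
  have h2 : t.leafSum (fun i => rad i - -rad i) = 2 * t.leafSum rad := by
    rw [show (fun i => rad i - -rad i) = (fun i => rad i + rad i) from funext fun i => by ring, Ledger.leafSum_add]; ring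
  have hrad : t.leafSum rad ≤ A * Real.exp (b + τ * c₁) * K₀ * (r * (Qy.card : ℝ) + 2 * σ₀ * (Qo.card : ℝ)) :=
    leafSum_remnant_radius_le_young_add_old ι hS (cubes := cubes) hloc hreach hd hA hK₀ hτ hr hσ₀ hr₁ hs hb hwAΛ hwBΛ
      hwA hwB hzero Young hrate hsizeA hsizeB h126 hvol hrate' hsmall hQy hQo hnd rem hinj
  rw [h2] at hw
  linarith

/-! ## §6 Sanity: the binders of §3 are jointly satisfiable with a nonzero discrepancy; the age-free case -/

section Sanity

/-- SANITY (non-vacuity of the hypothesis set of `discrepancy_budget_le_young_add_old`, with a NONZERO discrepancy): one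
polymer `()`, one cube `()`, `out () = {()}`, `d = 0`, `wA = 1`, `wB = 0`, old-born (Young = False) with σ₀ = 1, A = 1,
R = κ₀ = r₁ = s = τ = b = r = 0, c₁ = K₀ = 1, Q_o = {()}, Q_y = ∅: all binders hold and the inequality reads 1 ≤ 2. [folklore] -/
example : ∑ _Z ∈ ({()} : Finset Unit), ‖(1 : ℂ) - 0‖ *
      Real.exp (0 * ((({()} : Finset Unit)).card : ℝ) + ((0 + 0) * (0 : ℝ) + 0)) ≤
    1 * Real.exp (0 + 0 * 1) * 1 * (0 * ((∅ : Finset Unit).card : ℝ) + 2 * 1 * (({()} : Finset Unit).card : ℝ)) := by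
  have h := discrepancy_budget_le_young_add_old (Dom := Unit) (Cube := Unit) (Λ := {()}) (S := {()})
    (Finset.Subset.refl _) (out := fun _ => {()}) (d := fun _ => 0) (wA := fun _ => 1) (wB := fun _ => 0)
    (A := 1) (R := 0) (r₁ := 0) (s := 0) (κ₀ := 0) (K₀ := 1) (c₁ := 1) (b := 0) (τ := 0) (r := 0) (σ₀ := 1)
    (fun _ => le_rfl) zero_le_one le_rfl le_rfl zero_le_one
    (fun Z _ hZ => absurd (Finset.mem_singleton.2 (Subsingleton.elim Z ())) hZ) (fun _ => False)
    (fun _ _ h => h.elim) (fun _ _ _ => by simp) (fun _ _ _ => by simp)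
    (fun c => by simp [Finset.filter_singleton]) (fun Y _ => by simp) (by norm_num) (Qy := ∅) (Qo := {()})
    (fun _ _ h => h.elim) (fun _ _ _ => ⟨(), Finset.mem_singleton_self _, Finset.mem_singleton_self _⟩)
  exact h

/-- SANITY (the age-free case is print's one-run FORMAT read twice): with σ₀ = 1 (no banked slack) and every discrepant
polymer old (Young = False), the binders `hsizeA` / `hsizeB` are the one-run bound |F(Z)| ≤ A e^{−R d(Z)} itself and the
budget is the trivial 2·A e^{b+τc₁}·K₀·#Q_o — nothing two-run is used. [folklore] -/
example {Λ S : Finset Dom} (hS : S ⊆ Λ) {out : Dom → Finset Cube} {d : Dom → ℝ} {wA wB : Dom → ℂ}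
    {A R r₁ s κ₀ K₀ c₁ b τ : ℝ} (hd : ∀ Z, 0 ≤ d Z) (hA : 0 ≤ A) (hτ : 0 ≤ τ)
    (hzero : ∀ Z ∈ Λ, Z ∉ S → wA Z = wB Z)
    (hwA : ∀ Z, ‖wA Z‖ ≤ A * Real.exp (-(R * d Z))) (hwB : ∀ Z, ‖wB Z‖ ≤ A * Real.exp (-(R * d Z)))
    (h126 : Ineq126 Λ out d κ₀ K₀) (hvol : VolBound Λ out d c₁) (hrate' : κ₀ + (r₁ + s) + τ * c₁ ≤ R)
    {Qo : Finset Cube} (hQo : ∀ Z ∈ S, ∃ q ∈ Qo, q ∈ out Z) :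
    ∑ Z ∈ Λ, ‖wA Z - wB Z‖ * Real.exp (τ * ((out Z).card : ℝ) + ((r₁ + s) * d Z + b)) ≤
      A * Real.exp (b + τ * c₁) * K₀ * (0 * ((∅ : Finset Cube).card : ℝ) + 2 * 1 * (Qo.card : ℝ)) :=
  discrepancy_budget_le_young_add_old hS hd hA hτ le_rfl zero_le_one hzero (fun _ => False) (fun _ _ h => h.elim)
    (fun Z _ _ => by simpa using hwA Z) (fun Z _ _ => by simpa using hwB Z) h126 hvol hrate' (Qy := ∅)
    (fun _ _ h => h.elim) fun Z hZ _ => hQo Z hZ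

end Sanity

end Literature.MathematicalPhysics.QuantumFieldTheory.Balaban1983to89.T4TwoRunRateAssembly
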